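import Summits.QuantumFields.BalabanUV.Beta.GAN24.ArrowBlockLipschitz
import Summits.QuantumFields.BalabanUV.Beta.GAN24.StripAliasBounds
import Summits.QuantumFields.BalabanUV.Beta.GAN24.CapacitanceScalarDictionary

/-!
# `BalabanUV.Beta.GAN24.ArrowOuterShiftBlocks` — binder row G-an2-4 / (CONV-C), road P1-fibre, p1 row **P1-L10** `FibreStrip` ((I3′), the strip half of the
# K-slot), leaf-16's cut (M4) `L10-CUT-M4.md` row **F6 `ArrowOuterShift`** (OUTER LIPSCHITZ), PART 2: THE BLOCK HALF — every outer-scaled KKT block moves by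
# `≤ (48D² + 4D)·t·(1 + t)²`, `t = η/r_m`, under the imaginary shift `|Im p| ≤ η` at a real anchor

NOT IN PRINT; OUR PROOF ATTEMPT.  HONEST FRAMING (cell contract, verbatim): «discharging `BetaPertH` makes Bałaban's UV stability UNCONDITIONAL — a real
constructive-QFT result; it is NOT the continuum limit and NOT the Clay problem.»  HONEST DEPENDENCY (verbatim): «continuum YM on T⁴ ⇐ BetaPertH ∧ nine spine
estimates (0/9 proved); BetaPertH ⇐ (D1) ∧ (D4) ∧ CAP+tail; G-an2-4 gates asym, D1 and NE2/3/4.»  [folklore] bookkeeping BY NAME over part 1 `ArrowBlockLipschitz`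
(`norm_tBlock_sub_le`, F1a `ArrowOperator.tBlock`) and leaf-18's Y10g\* `StripAliasBounds` (`norm_dAl_sub_le`, `norm_dbAl_sub_le`, `norm_dAl_le`, `norm_dbAl_le`,
`norm_LAl_sub_lapR_le`, `norm_dAl_ofRealVec`); no cited fact, no wall binder, no `def`, no unit sequence touched (ref2 c2/c3).  NOT summit progress; discharges
nothing of the K-slot `GAN24.CombesThomas.ConvCK 3 Lc` (block input of F6 ⊂ F7 = (U1)).

## Setting and what is proved (T00 `AliasObjects` currency; every `D`, every `N ≥ 1`)
Real anchor `q : Fin D → ℝ`, a strip point `p` over it (`reVec p = q`, `|Im p_i| ≤ η`, `0 ≤ η ≤ 1`), an alias `m`, and its OUTER RADIUS `r > 0` with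
`r² = N²·lapR (kfine N q m)` (F1c's `radO N q m`; kept as a hypothesis so this file does not depend on F1c).  The outer-scaled block of leaf-16's cut is
`tBlock (c·∂_m) (c·∂♭_m) (c²·L_m)` with `c = N/r` (rows EL × N²/r², G × N³/r³; columns A × 1, μ × N/r).  With `t := η/r`:
* §1 anchor sizes: `‖c·∂_{mκ}(q)‖ ≤ 1`, `‖c·∂♭_{mκ}(q)‖ ≤ 1` (one term of `lapR`), `c²·L_m(q) = 1`;
* §2 shift sizes: `‖c·(∂_{mκ}(p) − ∂_{mκ}(q))‖ ≤ 2t` (flat twin), `‖c·∂_{mκ}(p)‖ ≤ 1 + 2t` (flat twin), `‖c²·(L_m(p) − L_m(q))‖ ≤ 4D·t + 4D·t²`;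
* §3 **`norm_outerBlock_sub_le`**: `‖tBlock (c·∂_m(p)) (c·∂♭_m(p)) (c²L_m(p)) − tBlock (c·∂_m(q)) (c·∂♭_m(q)) (c²L_m(q))‖ ≤ (48D² + 4D)·t·(1 + t)²`
  (part 1 `norm_tBlock_sub_le` with `a = 1 + 2t`, `ℓ = 1`, `ε = 2t`, `εL = 4Dt + 4Dt²`; the cubic in `t` is GENUINE: the A–μ/G–A entries are cubic in the
  normalised symbols, so at the zero alias (`r₀ ≍ |q|`) the honest outer modulus is `(1 + 1/|q|)³`, harmless in F7's outer region `|q| ≥ ρ₀/2`);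
* §4 radius facts for the sup over aliases (F6 proper): `m ≠ 0`, `q ∈ [−π,π]^D` ⇒ `2 ≤ r` (`four_le_sq_mul_lapR`); `m = 0`, `q ≠ 0` ⇒ `(2/π)·|q|₂ ≤ r`
  (`CapacitanceScalarBounds.le_sq_mul_lapR_zero`), so `t ≤ η/2` off the zero alias and `t ≤ (π/2)·η/|q|₂` on it.
Unit `b2b-balaban-gan24-formalise-leaf-10` (G-an2-4 formalisation swarm, leaf prover 10, gen 5), 2026-08-20.  Value = bookkeeping toward (I3′), NOT summit progress.
-/

noncomputable section

open Complex Finset Matrix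
open scoped BigOperators Real Matrix.Norms.L2Operator
open Literature.Probability.LatticeModels (TorusSite)
open Literature.MathematicalPhysics.QuantumFieldTheory.Balaban1983to89.B4Strip (ofRealVec reVec)
open Literature.MathematicalPhysics.QuantumFieldTheory.King1986 (momSq momSq_nonneg)

namespace Summit.QuantumFields.BalabanUV.Beta.GAN24.ArrowOuterShiftBlocks

open ArrowOperator (Loc tBlock)
open ArrowBlockLipschitz (norm_tBlock_sub_le)
open AliasWeights (kfine)
open AliasWeightsSum (lapR lapR_nonneg lapSym_ofReal four_le_sq_mul_lapR)
open AliasObjects (kAl dAl dbAl LAl)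
open StripAliasBounds (reVec_ofRealVec norm_dAl_sub_le norm_dbAl_sub_le norm_dAl_le norm_dbAl_le norm_LAl_sub_lapR_le norm_dAl_ofRealVec norm_dbAl_ofRealVec)

variable {D : ℕ} {N : ℕ} [NeZero N]

/-! ## §1 Anchor sizes of the outer-scaled symbols -/

/-- [folklore] One term of the Laplacian symbol: `(2|sin(x_κ/2)|)² ≤ lapR x`. -/
theorem four_sin_sq_le_lapR (x : Fin D → ℝ) (κ : Fin D) : (2 * |Real.sin (x κ / 2)|) ^ 2 ≤ lapR x := by
  rw [mul_pow, sq_abs]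
  unfold lapR
  have e : (2 : ℝ) ^ 2 * Real.sin (x κ / 2) ^ 2 = 4 * Real.sin (x κ / 2) ^ 2 := by norm_num
  rw [e]
  exact Finset.single_le_sum (f := fun i => 4 * Real.sin (x i / 2) ^ 2) (fun i _ => by positivity) (Finset.mem_univ κ)

omit [NeZero N] in
/-- [folklore] `2|sin(x_κ/2)| ≤ r/N` whenever `r > 0`, `r² = N²·lapR x` (`N ≥ 1`). -/
theorem two_abs_sin_le_div {x : Fin D → ℝ} {r : ℝ} (hN : 1 ≤ N) (hr0 : 0 < r) (hr : r ^ 2 = (N : ℝ) ^ 2 * lapR x) (κ : Fin D) :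
    2 * |Real.sin (x κ / 2)| ≤ r / N := by
  have hN0 : (0 : ℝ) < N := by exact_mod_cast hN
  have h1 : (2 * |Real.sin (x κ / 2)|) ^ 2 ≤ (r / N) ^ 2 := by
    rw [div_pow, le_div_iff₀ (by positivity)]
    calc (2 * |Real.sin (x κ / 2)|) ^ 2 * (N : ℝ) ^ 2 ≤ lapR x * (N : ℝ) ^ 2 :=
          mul_le_mul_of_nonneg_right (four_sin_sq_le_lapR x κ) (by positivity)
      _ = r ^ 2 := by rw [hr]; ring
  exact (pow_le_pow_iff_left₀ (by positivity) (by positivity) two_ne_zero).mp h1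

omit [NeZero N] in
/-- [folklore] `Σ_κ |sin(x_κ/2)| ≤ D·r/(2N)` (each term `≤ r/(2N)`). -/
theorem sum_abs_sin_le {x : Fin D → ℝ} {r : ℝ} (hN : 1 ≤ N) (hr0 : 0 < r) (hr : r ^ 2 = (N : ℝ) ^ 2 * lapR x) :
    ∑ κ, |Real.sin (x κ / 2)| ≤ D * (r / (2 * N)) := by
  calc ∑ κ, |Real.sin (x κ / 2)| ≤ ∑ _κ : Fin D, r / (2 * N) := Finset.sum_le_sum fun κ _ => by
          have := two_abs_sin_le_div hN hr0 hr κ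
          have hN0 : (0 : ℝ) < N := by exact_mod_cast hN
          rw [le_div_iff₀ (by positivity)] at *
          linarith
    _ = D * (r / (2 * N)) := by rw [Finset.sum_const, Finset.card_univ, Fintype.card_fin, nsmul_eq_mul]

omit [NeZero N] in
/-- [folklore] The norm of the scaling scalar: `‖(N : ℂ)/(r : ℂ)‖ = N/r` (`r > 0`). -/
theorem norm_scale {r : ℝ} (hr0 : 0 < r) : ‖((N : ℂ) / (r : ℂ))‖ = (N : ℝ) / r := by
  rw [norm_div, Complex.norm_natCast, Complex.norm_real, Real.norm_eq_abs, abs_of_pos hr0]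

variable {q : Fin D → ℝ} {m : TorusSite D N} {r : ℝ}

/-- [folklore] **ANCHOR SIZE OF THE NORMALISED `∂`**: `‖(N/r)·∂_{mκ}(q)‖ ≤ 1`. -/
theorem norm_scaled_dAl_anchor_le (hN : 1 ≤ N) (hr0 : 0 < r) (hr : r ^ 2 = (N : ℝ) ^ 2 * lapR (kfine N q m)) (κ : Fin D) :
    ‖((N : ℂ) / (r : ℂ)) * dAl N (ofRealVec q) m κ‖ ≤ 1 := by
  have hN0 : (0 : ℝ) < N := by exact_mod_cast hN
  rw [norm_mul, norm_scale hr0, norm_dAl_ofRealVec]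
  have h := two_abs_sin_le_div hN hr0 hr κ
  calc (N : ℝ) / r * (2 * |Real.sin (kfine N q m κ / 2)|) ≤ (N : ℝ) / r * (r / N) := mul_le_mul_of_nonneg_left h (by positivity)
    _ = 1 := by field_simp

/-- [folklore] **ANCHOR SIZE OF THE NORMALISED `∂♭`**: `‖(N/r)·∂♭_{mκ}(q)‖ ≤ 1`. -/
theorem norm_scaled_dbAl_anchor_le (hN : 1 ≤ N) (hr0 : 0 < r) (hr : r ^ 2 = (N : ℝ) ^ 2 * lapR (kfine N q m)) (κ : Fin D) :
    ‖((N : ℂ) / (r : ℂ)) * dbAl N (ofRealVec q) m κ‖ ≤ 1 := by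
  have hN0 : (0 : ℝ) < N := by exact_mod_cast hN
  rw [norm_mul, norm_scale hr0, norm_dbAl_ofRealVec]
  have h := two_abs_sin_le_div hN hr0 hr κ
  calc (N : ℝ) / r * (2 * |Real.sin (kfine N q m κ / 2)|) ≤ (N : ℝ) / r * (r / N) := mul_le_mul_of_nonneg_left h (by positivity)
    _ = 1 := by field_simp

/-- [folklore] **THE NORMALISED LAPLACIAN AT THE ANCHOR IS `1`**: `(N/r)²·L_m(q) = 1`. -/
theorem scaled_LAl_anchor_eq (hN : 1 ≤ N) (hr0 : 0 < r) (hr : r ^ 2 = (N : ℝ) ^ 2 * lapR (kfine N q m)) :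
    ((N : ℂ) / (r : ℂ)) ^ 2 * LAl N (ofRealVec q) m = 1 := by
  have hN0 : (N : ℂ) ≠ 0 := by exact_mod_cast (show (N : ℝ) ≠ 0 by exact_mod_cast (by omega : N ≠ 0))
  have hrC : (r : ℂ) ≠ 0 := by exact_mod_cast hr0.ne'
  rw [CapacitanceScalarDictionary.LAl_ofRealVec]
  have hl : ((lapR (kfine N q m) : ℝ) : ℂ) = (r : ℂ) ^ 2 / (N : ℂ) ^ 2 := by
    have : lapR (kfine N q m) = r ^ 2 / (N : ℝ) ^ 2 := by
      rw [hr]; field_simp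
    rw [this]; push_cast; ring
  rw [hl]
  field_simp

/-! ## §2 Shift sizes -/

variable {p : Fin D → ℂ} {η : ℝ}

/-- [folklore] **SHIFT OF THE NORMALISED `∂`**: `‖(N/r)·(∂_{mκ}(p) − ∂_{mκ}(q))‖ ≤ 2η/r` (`reVec p = q`, `|Im p_i| ≤ η ≤ 1`). -/
theorem norm_scaled_dAl_sub_le (hN : 1 ≤ N) (hpq : reVec p = q) (him : ∀ i, |(p i).im| ≤ η) (hη1 : η ≤ 1) (hr0 : 0 < r) (κ : Fin D) :
    ‖((N : ℂ) / (r : ℂ)) * dAl N p m κ - ((N : ℂ) / (r : ℂ)) * dAl N (ofRealVec q) m κ‖ ≤ 2 * (η / r) := by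
  have hN0 : (0 : ℝ) < N := by exact_mod_cast hN
  rw [← mul_sub, norm_mul, norm_scale hr0]
  have h := norm_dAl_sub_le (N := N) him hη1 m κ
  rw [hpq] at h
  calc (N : ℝ) / r * ‖dAl N p m κ - dAl N (ofRealVec q) m κ‖ ≤ (N : ℝ) / r * (2 * (η / N)) := mul_le_mul_of_nonneg_left h (by positivity)
    _ = 2 * (η / r) := by field_simp

/-- [folklore] Flat twin: `‖(N/r)·(∂♭_{mκ}(p) − ∂♭_{mκ}(q))‖ ≤ 2η/r`. -/
theorem norm_scaled_dbAl_sub_le (hN : 1 ≤ N) (hpq : reVec p = q) (him : ∀ i, |(p i).im| ≤ η) (hη1 : η ≤ 1) (hr0 : 0 < r) (κ : Fin D) :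
    ‖((N : ℂ) / (r : ℂ)) * dbAl N p m κ - ((N : ℂ) / (r : ℂ)) * dbAl N (ofRealVec q) m κ‖ ≤ 2 * (η / r) := by
  have hN0 : (0 : ℝ) < N := by exact_mod_cast hN
  rw [← mul_sub, norm_mul, norm_scale hr0]
  have h := norm_dbAl_sub_le (N := N) him hη1 m κ
  rw [hpq] at h
  calc (N : ℝ) / r * ‖dbAl N p m κ - dbAl N (ofRealVec q) m κ‖ ≤ (N : ℝ) / r * (2 * (η / N)) := mul_le_mul_of_nonneg_left h (by positivity)
    _ = 2 * (η / r) := by field_simp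

/-- [folklore] `‖(N/r)·∂_{mκ}(p)‖ ≤ 1 + 2η/r` on the strip. -/
theorem norm_scaled_dAl_le (hN : 1 ≤ N) (hpq : reVec p = q) (him : ∀ i, |(p i).im| ≤ η) (hη1 : η ≤ 1) (hr0 : 0 < r)
    (hr : r ^ 2 = (N : ℝ) ^ 2 * lapR (kfine N q m)) (κ : Fin D) :
    ‖((N : ℂ) / (r : ℂ)) * dAl N p m κ‖ ≤ 1 + 2 * (η / r) := by
  have h1 := norm_scaled_dAl_anchor_le hN hr0 hr κ
  have h2 := norm_scaled_dAl_sub_le (m := m) hN hpq him hη1 hr0 κ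
  calc ‖((N : ℂ) / (r : ℂ)) * dAl N p m κ‖
      = ‖((N : ℂ) / (r : ℂ)) * dAl N (ofRealVec q) m κ + (((N : ℂ) / (r : ℂ)) * dAl N p m κ - ((N : ℂ) / (r : ℂ)) * dAl N (ofRealVec q) m κ)‖ := by
        rw [add_sub_cancel]
    _ ≤ 1 + 2 * (η / r) := (norm_add_le _ _).trans (add_le_add h1 h2)

/-- [folklore] `‖(N/r)·∂♭_{mκ}(p)‖ ≤ 1 + 2η/r` on the strip. -/
theorem norm_scaled_dbAl_le (hN : 1 ≤ N) (hpq : reVec p = q) (him : ∀ i, |(p i).im| ≤ η) (hη1 : η ≤ 1) (hr0 : 0 < r)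
    (hr : r ^ 2 = (N : ℝ) ^ 2 * lapR (kfine N q m)) (κ : Fin D) :
    ‖((N : ℂ) / (r : ℂ)) * dbAl N p m κ‖ ≤ 1 + 2 * (η / r) := by
  have h1 := norm_scaled_dbAl_anchor_le hN hr0 hr κ
  have h2 := norm_scaled_dbAl_sub_le (m := m) hN hpq him hη1 hr0 κ
  calc ‖((N : ℂ) / (r : ℂ)) * dbAl N p m κ‖
      = ‖((N : ℂ) / (r : ℂ)) * dbAl N (ofRealVec q) m κ + (((N : ℂ) / (r : ℂ)) * dbAl N p m κ - ((N : ℂ) / (r : ℂ)) * dbAl N (ofRealVec q) m κ)‖ := by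
        rw [add_sub_cancel]
    _ ≤ 1 + 2 * (η / r) := (norm_add_le _ _).trans (add_le_add h1 h2)

/-- [folklore] **SHIFT OF THE NORMALISED LAPLACIAN**: `‖(N/r)²·(L_m(p) − L_m(q))‖ ≤ 4D·(η/r) + 4D·(η/r)²`. -/
theorem norm_scaled_LAl_sub_le (hN : 1 ≤ N) (hpq : reVec p = q) (him : ∀ i, |(p i).im| ≤ η) (hη0 : 0 ≤ η) (hη1 : η ≤ 1) (hr0 : 0 < r)
    (hr : r ^ 2 = (N : ℝ) ^ 2 * lapR (kfine N q m)) :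
    ‖((N : ℂ) / (r : ℂ)) ^ 2 * LAl N p m - ((N : ℂ) / (r : ℂ)) ^ 2 * LAl N (ofRealVec q) m‖ ≤ 4 * D * (η / r) + 4 * D * (η / r) ^ 2 := by
  have hN0 : (0 : ℝ) < N := by exact_mod_cast hN
  rw [← mul_sub, norm_mul, norm_pow, norm_scale hr0, CapacitanceScalarDictionary.LAl_ofRealVec]
  have h := norm_LAl_sub_lapR_le (N := N) him hη1 m
  rw [hpq] at h
  have hs := sum_abs_sin_le (x := kfine N q m) hN hr0 hr
  have h2 : ‖LAl N p m - ((lapR (kfine N q m) : ℝ) : ℂ)‖ ≤ 8 * (η / N) * (D * (r / (2 * N))) + 4 * D * (η / N) ^ 2 :=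
    h.trans (add_le_add (mul_le_mul_of_nonneg_left hs (by positivity)) le_rfl)
  calc ((N : ℝ) / r) ^ 2 * ‖LAl N p m - ((lapR (kfine N q m) : ℝ) : ℂ)‖
      ≤ ((N : ℝ) / r) ^ 2 * (8 * (η / N) * (D * (r / (2 * N))) + 4 * D * (η / N) ^ 2) := mul_le_mul_of_nonneg_left h2 (by positivity)
    _ = 4 * D * (η / r) + 4 * D * (η / r) ^ 2 := by field_simp; ring

/-! ## §3 The outer-scaled block moves by `(48D² + 4D)·t·(1 + t)²` -/

/-- [folklore] **OUTER BLOCK LIPSCHITZ BOUND.**  For `N ≥ 1`, a real anchor `q`, a strip point `p` over it (`reVec p = q`, `|Im p_i| ≤ η`, `0 ≤ η ≤ 1`), an alias `m`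
with outer radius `r > 0`, `r² = N²·lapR (kfine N q m)`, and `t = η/r`:
`‖tBlock (c∂_m(p)) (c∂♭_m(p)) (c²L_m(p)) − tBlock (c∂_m(q)) (c∂♭_m(q)) (c²L_m(q))‖ ≤ (48D² + 4D)·t·(1 + t)²`, `c = N/r` (L2 operator norm). -/
theorem norm_outerBlock_sub_le (hN : 1 ≤ N) (hpq : reVec p = q) (him : ∀ i, |(p i).im| ≤ η) (hη0 : 0 ≤ η) (hη1 : η ≤ 1)
    (m : TorusSite D N) (hr0 : 0 < r) (hr : r ^ 2 = (N : ℝ) ^ 2 * lapR (kfine N q m)) :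
    ‖tBlock (fun κ => ((N : ℂ) / (r : ℂ)) * dAl N p m κ) (fun κ => ((N : ℂ) / (r : ℂ)) * dbAl N p m κ) (((N : ℂ) / (r : ℂ)) ^ 2 * LAl N p m)
        - tBlock (fun κ => ((N : ℂ) / (r : ℂ)) * dAl N (ofRealVec q) m κ) (fun κ => ((N : ℂ) / (r : ℂ)) * dbAl N (ofRealVec q) m κ)
            (((N : ℂ) / (r : ℂ)) ^ 2 * LAl N (ofRealVec q) m)‖
      ≤ (48 * D ^ 2 + 4 * D) * (η / r) * (1 + η / r) ^ 2 := by
  set t := η / r with ht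
  have ht0 : 0 ≤ t := div_nonneg hη0 hr0.le
  have hD : (0 : ℝ) ≤ D := Nat.cast_nonneg D
  have key := norm_tBlock_sub_le
    (fun κ => ((N : ℂ) / (r : ℂ)) * dAl N (ofRealVec q) m κ) (fun κ => ((N : ℂ) / (r : ℂ)) * dbAl N (ofRealVec q) m κ)
    (fun κ => ((N : ℂ) / (r : ℂ)) * dAl N p m κ) (fun κ => ((N : ℂ) / (r : ℂ)) * dbAl N p m κ)
    (((N : ℂ) / (r : ℂ)) ^ 2 * LAl N (ofRealVec q) m) (((N : ℂ) / (r : ℂ)) ^ 2 * LAl N p m)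
    (a := 1 + 2 * t) (ℓ := 1) (ε := 2 * t) (εL := 4 * D * t + 4 * D * t ^ 2)
    (by positivity) zero_le_one (by positivity) (by positivity)
    (fun κ => (norm_scaled_dAl_anchor_le hN hr0 hr κ).trans (by linarith))
    (fun κ => norm_scaled_dAl_le hN hpq him hη1 hr0 hr κ)
    (fun κ => norm_scaled_dbAl_le hN hpq him hη1 hr0 hr κ)
    (by rw [scaled_LAl_anchor_eq hN hr0 hr, norm_one])
    (fun κ => norm_scaled_dAl_sub_le hN hpq him hη1 hr0 κ)
    (fun κ => norm_scaled_dbAl_sub_le hN hpq him hη1 hr0 κ)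
    (norm_scaled_LAl_sub_le hN hpq him hη0 hη1 hr0 hr)
  refine key.trans ?_
  have hgap : (48 * (D : ℝ) ^ 2 + 4 * D) * t * (1 + t) ^ 2
      - (2 * D * (4 * D * t + 4 * D * t ^ 2) + 4 * D ^ 2 * (1 + 2 * t) * (2 * t) + 2 * D * ((1 + 2 * t) * (4 * D * t + 4 * D * t ^ 2) + 1 * (2 * t)))
      = 24 * D ^ 2 * t + (48 * D ^ 2 + 8 * D) * t ^ 2 + (32 * D ^ 2 + 4 * D) * t ^ 3 := by ring
  have hpos : 0 ≤ 24 * (D : ℝ) ^ 2 * t + (48 * D ^ 2 + 8 * D) * t ^ 2 + (32 * D ^ 2 + 4 * D) * t ^ 3 := by positivity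
  linarith

/-! ## §4 Radius facts for the sup over aliases -/

/-- [folklore] GOOD ALIASES: `m ≠ 0`, `q ∈ [−π, π]^D` ⇒ `2 ≤ r` (`r² = N²·lapR ≥ 4`, leaf P1-L06 `four_le_sq_mul_lapR`). -/
theorem two_le_rad (hq : ∀ i, |q i| ≤ π) (hm : m ≠ 0) (hr0 : 0 < r) (hr : r ^ 2 = (N : ℝ) ^ 2 * lapR (kfine N q m)) : 2 ≤ r := by
  have h4 : (2 : ℝ) ^ 2 ≤ r ^ 2 := by rw [hr]; norm_num; exact four_le_sq_mul_lapR hq hm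
  exact (pow_le_pow_iff_left₀ (by norm_num) hr0.le two_ne_zero).mp h4

omit [NeZero N] in
/-- [folklore] ZERO ALIAS: `q ∈ [−π, π]^D` ⇒ `(2/π)·|q|₂ ≤ r₀` (`r₀² = N²·lapR(q/N) ≥ (4/π²)|q|²`, leaf-12's `le_sq_mul_lapR_zero`). -/
theorem two_div_pi_mul_le_rad_zero (hN : 1 ≤ N) (hq : ∀ i, |q i| ≤ π) (hr0 : 0 < r) (hr : r ^ 2 = (N : ℝ) ^ 2 * lapR (kfine N q 0)) :
    2 / π * Real.sqrt (momSq q) ≤ r := by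
  have hπ : (0 : ℝ) < π := Real.pi_pos
  have h := CapacitanceScalarBounds.le_sq_mul_lapR_zero (D := D) hN hq
  have h1 : (2 / π * Real.sqrt (momSq q)) ^ 2 ≤ r ^ 2 := by
    rw [mul_pow, div_pow, Real.sq_sqrt (momSq_nonneg q), hr]
    have e : (2 : ℝ) ^ 2 / π ^ 2 * momSq q = 4 / π ^ 2 * momSq q := by norm_num
    rw [e]; exact h
  exact (pow_le_pow_iff_left₀ (by positivity) hr0.le two_ne_zero).mp h1

/-- [folklore] Consequently `t = η/r ≤ η/2` off the zero alias … -/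
theorem div_rad_le_half (hq : ∀ i, |q i| ≤ π) (hm : m ≠ 0) (hr0 : 0 < r) (hr : r ^ 2 = (N : ℝ) ^ 2 * lapR (kfine N q m)) (hη0 : 0 ≤ η) :
    η / r ≤ η / 2 :=
  div_le_div_of_nonneg_left hη0 two_pos (two_le_rad hq hm hr0 hr)

omit [NeZero N] in
/-- [folklore] … and `t = η/r₀ ≤ (π/2)·η/|q|₂` on it (`q ≠ 0`). -/
theorem div_rad_zero_le (hN : 1 ≤ N) (hq : ∀ i, |q i| ≤ π) (hq0 : q ≠ 0) (hr0 : 0 < r) (hr : r ^ 2 = (N : ℝ) ^ 2 * lapR (kfine N q 0))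
    (hη0 : 0 ≤ η) : η / r ≤ π / 2 * (η / Real.sqrt (momSq q)) := by
  have hπ : (0 : ℝ) < π := Real.pi_pos
  have hs : 0 < Real.sqrt (momSq q) := Real.sqrt_pos.2 (CapacitanceScalarBounds.momSq_pos hq0)
  have h := two_div_pi_mul_le_rad_zero hN hq hr0 hr
  rw [show π / 2 * (η / Real.sqrt (momSq q)) = η / (2 / π * Real.sqrt (momSq q)) by field_simp]
  exact div_le_div_of_nonneg_left hη0 (by positivity) h

end Summit.QuantumFields.BalabanUV.Beta.GAN24.ArrowOuterShiftBlocks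

end
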